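import Summits.BirchSwinnertonDyer.Rank1Residual.AdditivePotMult.GreenbergVatsalTransferSingleCongruence
import Summits.BirchSwinnertonDyer.Rank1Residual.Additive.SelmerGVEqualityBadPlaces
import Summits.BirchSwinnertonDyer.Rank1Residual.X2.NonPrimitiveSelmerDual
import Summits.BirchSwinnertonDyer.BirchSwinnertonDyer.Theorems.PlecticLegsArtinBaseChangePlaces
import Literature.NumberTheory.EllipticCurves.GreenbergVatsal2000.NonPrimitiveDatumSelmerInvariants
import Literature.NumberTheory.EllipticCurves.GreenbergVatsal2000.MuLambdaTransferRamifiedOrdinary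
import Literature.NumberTheory.EllipticCurves.IwasawaSelmerIsTorsionProofs
import HarnessLib

/-!
# A240 DERIVED: Greenberg–Vatsal's `μ = 0` / `λ`-shift transfer at the ramified ordinary line
# (`GreenbergVatsal2000.muLambdaAlg_transfer_of_torsionIso_potOrd_of_not_dvd_torsionOrder`, the
# cell's composed record A240) from the two lighter printed records T-GV23L (`h23`, GV Cor. (2.3) +
# Prop. (2.4) at the datum) and A234 (`h414`, Greenberg 1999 Prop. 4.14) — everything else in the
# kernel (cell `b2b-bsdres`, team n1011, seat p12 (gen 6); row T-A240-K, FILE K4 = the assembly)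

HONEST FRAMING (cell `b2b-bsdres`, run/shared/lean/b2b/bsd-rank1-residual/, verbatim in every
file): the goal of the cell is to DELETE the COMBINATION-SHAPED residual classes of the
Birch–Swinnerton-Dyer formula for ALL analytic-rank `≤ 1` elliptic curves over `ℚ` — "full BSD
formula for every rank `≤ 1` curve in class `C`" assembled STRICTLY from published theorems — so
that the rank-`≤ 1` remainder becomes exactly the CONSTRUCTION-SHAPED classes, which are TYPED
(missing-input `Prop`s), NOT attempted. This is not "finishing BSD". Team n1011: research routes on
CONSTRUCTION-SHAPED classes; prove what is provable now; no claim beyond stated classes; census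
output = EVIDENCE, never a Literature fact; RESIDUAL-MAP marks UNCHANGED; nothing is booked by this
file. THEOREMS ONLY: no definition, no named fact. The two cited records enter as the displayed
binders `h23`, `h414`; A240 is not touched (its file stays as the citation of record until the
literature seat re-labels it DERIVED).

## What and why

A240 (cc-typer-2, p264989) is the COMPOSED citation of GV pp. 26–27 run at the ramified ordinary line
of an additive potentially ordinary / potentially multiplicative odd prime: for `E₁[p] ≅ E₂[p]`
carrying `C₁[p]` onto `C₂[p]`, `p ∤ #E_i(ℚ)_tors`, the R-D identifications at `𝔭` and torsion dual
data, `μ(X₁) = 0 ⟹ μ(X₂) = 0 ∧ λ(X₁) + Σδ₁ = λ(X₂) + Σδ₂`. After GV29o (gen 5), T-GV29-MF and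
FILES K3/K4a (this gen) its residual PRINT content was exactly GV Cor. (2.3) + Prop. (2.4) (the
primitive ↔ non-primitive passage) and Greenberg's Prop. 4.14 (no finite submodule). n1011-lit's
T-GV23L record `datumSelmer_nonPrimitive_invariants` (p285310) is the former at the datum; p06's
T-A240-PORT (p287268, p287807, p288232) identifies the classical groups with the datum groups. THIS
FILE assembles:

* §1 `forall_exists_lines_of_single`, `forall_greenbergKer_eq_of_single` — over `ℚ` ONE place above
  `p` (PlecticLegs' `HeightOneSpectrum.eq_of_natCast_mem`) and ONE ramified ordinary line there
  (cc-typer-2's model-free uniqueness): A240's single `(v, L₁, L₂)` gives the family shapes;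
* §2 `exists_datumDualData_of_selmerDualData`, `exists_datumDualData_of_nonPrimitiveDualData` — a
  classical dual datum IS a `DatumDualData` of the equal datum group (existence form, `refl`
  equivalence); `record_consequences_of_eq` — `h23` read in classical currency: `X^{Σ₀}` f.g. torsion,
  `μ(X^{Σ₀}) = μ(X)`, `λ(X^{Σ₀}) = λ(X) + Σδ`, `Sel^{Σ₀}/Sel` `p`-divisible;
* §3 **`muLambdaAlg_transfer_of_torsionIso_potOrd_of_not_dvd_torsionOrder_of_records
  (h23 : datumSelmer_nonPrimitive_invariants)
  (h414 : Greenberg1999.prop414_noFiniteSubmodule_of_not_dvd_torsionOrder) :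
  muLambdaAlg_transfer_of_torsionIso_potOrd_of_not_dvd_torsionOrder`** — A240's statement VERBATIM,
  via FILE K4a's core `mu_eq_zero_and_lambda_add_sum_delta_eq_of_congruence` (gen-5 FILES 4–6, K3,
  T-GV29-MF).

So A240 = (T-GV23L) + (A234) + kernel; the debt arithmetic (A240 ↦ DERIVED) is the literature
seat's call. NOT here: the records themselves; `IsCyclotomicVariable` is not used (A240 carries it).

References: [GreenbergVatsal2000] §2 Prop. (2.1), Cor. (2.3), Prop. (2.4), Prop. (2.8), Remark (2.9),
pp. 26–27 (arXiv:math/9906215); [GreenbergLNM1716] Prop. 4.14, Prop. 5.10.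
-/

set_option autoImplicit false

noncomputable section

open scoped Classical NumberField AddSubgroup

open NumberField IsDedekindDomain Field WeierstrassCurve
  Literature.NumberTheory.GaloisRepresentations Literature.NumberTheory.EllipticCurves
  Literature.NumberTheory.EllipticCurves.GreenbergSelmer
  Literature.NumberTheory.EllipticCurves.GreenbergVatsal2000
  Literature.NumberTheory.EllipticCurves.EmertonPollackWeston2006
  Summit.BirchSwinnertonDyer.BirchSwinnertonDyer.Theorems
  Summit.BirchSwinnertonDyer.Rank1Residual.X2.NonPrimitiveSelmerDual

namespace Summit.BirchSwinnertonDyer.Rank1Residual.Additive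

/-! ## §1. Over `ℚ`: one place above `p`, one ramified ordinary line -/

section Adapters

variable {p : ℕ} [hp : Fact p.Prime] {W₁ W₂ : WeierstrassCurve ℚ} [W₁.IsElliptic] [W₂.IsElliptic]
  {v : HeightOneSpectrum (𝓞 ℚ)}

omit [W₁.IsElliptic] [W₂.IsElliptic] in
/-- Over `ℚ` there is ONE place above `p`: ramified ordinary lines `L₁`, `L₂` at `v ∋ p` matched by `e`
give the `∀ v' ∋ p`-family shape of the transfer files. [folklore] -/
theorem forall_exists_lines_of_single (hpv : ((p : ℕ) : 𝓞 ℚ) ∈ v.asIdeal)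
    (L₁ : LocalDatum ℚ (W₁.geomPrimaryTorsion p) v) (L₂ : LocalDatum ℚ (W₂.geomPrimaryTorsion p) v)
    (hL₁ : IsRamifiedOrdinaryLine W₁ p L₁) (hL₂ : IsRamifiedOrdinaryLine W₂ p L₂)
    (e : geomTorsion W₁ (p : ℤ) ≃+ geomTorsion W₂ (p : ℤ))
    (hmatch : ∀ P : geomTorsion W₁ (p : ℤ),
      AddSubgroup.inclusion (geomTorsion_le_geomPrimaryTorsion W₁ p) P ∈ L₁.plus ↔
        AddSubgroup.inclusion (geomTorsion_le_geomPrimaryTorsion W₂ p) (e P) ∈ L₂.plus) :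
    ∀ (v' : HeightOneSpectrum (𝓞 ℚ)) (hv' : ((p : ℕ) : 𝓞 ℚ) ∈ v'.asIdeal),
      ∃ (L₁' : LocalDatum ℚ (W₁.geomPrimaryTorsion p) v') (L₂' : LocalDatum ℚ (W₂.geomPrimaryTorsion p) v'),
        IsRamifiedOrdinaryLine W₁ p L₁' ∧ IsRamifiedOrdinaryLine W₂ p L₂' ∧
        ∀ P : geomTorsion W₁ (p : ℤ),
          AddSubgroup.inclusion (geomTorsion_le_geomPrimaryTorsion W₁ p) P ∈ L₁'.plus ↔
            AddSubgroup.inclusion (geomTorsion_le_geomPrimaryTorsion W₂ p) (e P) ∈ L₂'.plus := by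
  intro v' hv'
  obtain rfl : v' = v := HeightOneSpectrum.eq_of_natCast_mem hp.out hpv hv'
  exact ⟨L₁, L₂, hL₁, hL₂, hmatch⟩

omit [W₂.IsElliptic] in
/-- Over `ℚ`, ONE place above `p` and ONE ramified ordinary line there (cc-typer-2's model-free
uniqueness): the R-D identification of one ramified ordinary line is the R-D identification of every
ramified ordinary line at every place above `p`. [cite: GreenbergVatsal2000, §2 p. 26] -/
theorem forall_greenbergKer_eq_of_single (hpv : ((p : ℕ) : 𝓞 ℚ) ∈ v.asIdeal) (κ : ZpExtension ℚ p)
    {L₁ : LocalDatum ℚ (W₁.geomPrimaryTorsion p) v} (hL₁ : IsRamifiedOrdinaryLine W₁ p L₁)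
    (hRD : L₁.greenbergKer κ.kerSubgroup = W₁.localKerOver p κ.kerSubgroup (v.adicCompletion ℚ)) :
    ∀ (v' : HeightOneSpectrum (𝓞 ℚ)) (hv' : ((p : ℕ) : 𝓞 ℚ) ∈ v'.asIdeal)
      (L : LocalDatum ℚ (W₁.geomPrimaryTorsion p) v'), IsRamifiedOrdinaryLine W₁ p L →
      L.greenbergKer κ.kerSubgroup = W₁.localKerOver p κ.kerSubgroup (v'.adicCompletion ℚ) := by
  intro v' hv' L hL
  obtain rfl : v' = v := HeightOneSpectrum.eq_of_natCast_mem hp.out hpv hv'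
  obtain rfl : L = L₁ := hL.eq_of_isRamifiedOrdinaryLine hL₁ hpv
  exact hRD

end Adapters

/-! ## §2. Classical dual data as datum dual data; the record in classical currency -/

section RecordConsequences

variable {p : ℕ} [hp : Fact p.Prime] {W : WeierstrassCurve ℚ} [W.IsElliptic] [W.IsGloballyMinimal]
  {κ : ZpExtension ℚ p} {γ : absoluteGaloisGroup ℚ}

omit [W.IsElliptic] [W.IsGloballyMinimal] in
/-- **A classical dual datum of `Sel_{p^∞}(E/ℚ_∞)` IS a datum dual of `S_A(ℚ_∞)`** once the two groups
coincide (`Sel_E(ℚ_∞)_p = S_A(ℚ_∞)`, p06's `selmerInfty_eq_datumSelmerInfty` under the R-D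
identification): n1011-lit's `DatumDualData` structure is inhabited by `D.X` itself, re-read through
the identity isomorphism of the equal subgroups (the `Λ`-linear equivalence is `refl`). Existence
form (no definition introduced). [cite: GreenbergVatsal2000, §2 p. 17 and pp. 20–21] -/
theorem exists_datumDualData_of_selmerDualData (Lf : Data ℚ (W.geomPrimaryTorsion p) p)
    (hSel : W.selmerInfty κ =
      datumSelmerInfty κ (W.geomPrimaryTorsion p) Lf (∅ : Set (HeightOneSpectrum (𝓞 ℚ))))
    (D : W.SelmerDualData κ γ) :
    ∃ X : DatumDualData κ γ (W.geomPrimaryTorsion p) Lf (∅ : Set (HeightOneSpectrum (𝓞 ℚ))),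
      Nonempty (X.X ≃ₗ[IwasawaAlgebra p] D.X) := by
  let ι : ↥(datumSelmerInfty κ (W.geomPrimaryTorsion p) Lf (∅ : Set (HeightOneSpectrum (𝓞 ℚ)))) ≃+
      ↥(W.selmerInfty κ) := AddEquiv.addSubgroupCongr hSel.symm
  have hιval : ∀ s, ((ι s : ↥(W.selmerInfty κ)) : W.subgroupH1 p κ.kerSubgroup) =
      (s : W.subgroupH1 p κ.kerSubgroup) := fun s ↦ AddEquiv.addSubgroupCongr_apply hSel.symm s
  let td : D.X →+ (↥(datumSelmerInfty κ (W.geomPrimaryTorsion p) Lf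
      (∅ : Set (HeightOneSpectrum (𝓞 ℚ)))) →+ AddCircle (1 : ℚ)) :=
    { toFun := fun x ↦ (D.toDual x).comp ι.toAddMonoidHom
      map_zero' := by ext s; rw [AddMonoidHom.comp_apply, map_zero, AddMonoidHom.zero_apply,
        AddMonoidHom.zero_apply]
      map_add' := fun x y ↦ by ext s; simp only [AddMonoidHom.comp_apply, map_add,
        AddMonoidHom.add_apply] }
  have htd : ∀ x s, td x s = D.toDual x (ι s) := fun _ _ ↦ rfl
  have hbij : Function.Bijective td := by
    constructor
    · intro x y hxy
      apply D.bijective.1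
      ext s
      have h := DFunLike.congr_fun hxy (ι.symm s)
      rw [htd, htd, AddEquiv.apply_symm_apply] at h
      exact h
    · intro χ
      obtain ⟨x, hx⟩ := D.bijective.2 (χ.comp ι.symm.toAddMonoidHom)
      refine ⟨x, ?_⟩
      ext s
      rw [htd, hx, AddMonoidHom.comp_apply, AddEquiv.coe_toAddMonoidHom, AddEquiv.symm_apply_apply]
  have hT : ∀ (x : D.X) (s : ↥(datumSelmerInfty κ (W.geomPrimaryTorsion p) Lf
      (∅ : Set (HeightOneSpectrum (𝓞 ℚ))))),
      td ((PowerSeries.X : IwasawaAlgebra p) • x) s =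
        td x ⟨conjH1 κ.kerSubgroup (W.geomPrimaryTorsion p) γ s,
          conjH1_mem_datumSelmer κ.kerSubgroup (W.geomPrimaryTorsion p) p Lf _ γ s.2⟩ - td x s := by
    intro x s
    have key : (⟨W.conjH1 p κ.kerSubgroup γ ((ι s : ↥(W.selmerInfty κ)) : W.subgroupH1 p κ.kerSubgroup),
        D.conj_mem _ (ι s).2⟩ : ↥(W.selmerInfty κ)) =
        ι ⟨conjH1 κ.kerSubgroup (W.geomPrimaryTorsion p) γ s,
          conjH1_mem_datumSelmer κ.kerSubgroup (W.geomPrimaryTorsion p) p Lf _ γ s.2⟩ :=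
      Subtype.ext ((congrArg (W.conjH1 p κ.kerSubgroup γ) (hιval s)).trans
        (hιval ⟨conjH1 κ.kerSubgroup (W.geomPrimaryTorsion p) γ s,
          conjH1_mem_datumSelmer κ.kerSubgroup (W.geomPrimaryTorsion p) p Lf _ γ s.2⟩).symm)
    rw [htd, htd, htd, ← key]
    exact D.toDual_T_smul x (ι s)
  have hCst : ∀ (c : ℤ_[p]) (x : D.X) (s : ↥(datumSelmerInfty κ (W.geomPrimaryTorsion p) Lf
      (∅ : Set (HeightOneSpectrum (𝓞 ℚ))))) (k : ℕ), (p ^ k) • s = 0 →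
      td (PowerSeries.C c • x) s = (PadicInt.toZModPow k c).val • td x s := by
    intro c x s k hk
    rw [htd, htd]
    exact D.toDual_C_smul c x (ι s) k (by rw [← map_nsmul, hk, map_zero])
  exact ⟨{ X := D.X, toDual := td, bijective := hbij, toDual_T_smul := hT, toDual_C_smul := hCst },
    ⟨LinearEquiv.refl _ _⟩⟩

omit [W.IsElliptic] [W.IsGloballyMinimal] in
/-- **A classical dual datum of `Sel^{Σ₀}_E(ℚ_∞)_p` IS a datum dual of `S^{Σ₀}_A(ℚ_∞)`** once the
two groups coincide (`Sel^{Σ₀}_E(ℚ_∞)_p = S^{Σ₀}_A(ℚ_∞)`, gen-5 FILE 3 / p06's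
`nonPrimitiveSelmerInfty_eq_datumSelmerInfty`). Existence form. [cite: GreenbergVatsal2000, §2 p. 17 and pp. 20–21] -/
theorem exists_datumDualData_of_nonPrimitiveDualData (Lf : Data ℚ (W.geomPrimaryTorsion p) p)
    (S₀ : Set (HeightOneSpectrum (𝓞 ℚ)))
    (hNP : nonPrimitiveSelmerInfty W κ S₀ = datumSelmerInfty κ (W.geomPrimaryTorsion p) Lf S₀)
    (DS : NonPrimitiveDualData W κ γ S₀) :
    ∃ X₀ : DatumDualData κ γ (W.geomPrimaryTorsion p) Lf S₀,
      Nonempty (X₀.X ≃ₗ[IwasawaAlgebra p] DS.X) := by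
  let ι : ↥(datumSelmerInfty κ (W.geomPrimaryTorsion p) Lf S₀) ≃+ ↥(nonPrimitiveSelmerInfty W κ S₀) :=
    AddEquiv.addSubgroupCongr hNP.symm
  have hιval : ∀ s, ((ι s : ↥(nonPrimitiveSelmerInfty W κ S₀)) : W.subgroupH1 p κ.kerSubgroup) =
      (s : W.subgroupH1 p κ.kerSubgroup) := fun s ↦ AddEquiv.addSubgroupCongr_apply hNP.symm s
  let td : DS.X →+ (↥(datumSelmerInfty κ (W.geomPrimaryTorsion p) Lf S₀) →+ AddCircle (1 : ℚ)) :=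
    { toFun := fun x ↦ (DS.toDual x).comp ι.toAddMonoidHom
      map_zero' := by ext s; rw [AddMonoidHom.comp_apply, map_zero, AddMonoidHom.zero_apply,
        AddMonoidHom.zero_apply]
      map_add' := fun x y ↦ by ext s; simp only [AddMonoidHom.comp_apply, map_add,
        AddMonoidHom.add_apply] }
  have htd : ∀ x s, td x s = DS.toDual x (ι s) := fun _ _ ↦ rfl
  have hbij : Function.Bijective td := by
    constructor
    · intro x y hxy
      apply DS.bijective.1
      ext s
      have h := DFunLike.congr_fun hxy (ι.symm s)
      rw [htd, htd, AddEquiv.apply_symm_apply] at h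
      exact h
    · intro χ
      obtain ⟨x, hx⟩ := DS.bijective.2 (χ.comp ι.symm.toAddMonoidHom)
      refine ⟨x, ?_⟩
      ext s
      rw [htd, hx, AddMonoidHom.comp_apply, AddEquiv.coe_toAddMonoidHom, AddEquiv.symm_apply_apply]
  have hT : ∀ (x : DS.X) (s : ↥(datumSelmerInfty κ (W.geomPrimaryTorsion p) Lf S₀)),
      td ((PowerSeries.X : IwasawaAlgebra p) • x) s =
        td x ⟨conjH1 κ.kerSubgroup (W.geomPrimaryTorsion p) γ s,
          conjH1_mem_datumSelmer κ.kerSubgroup (W.geomPrimaryTorsion p) p Lf _ γ s.2⟩ - td x s := by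
    intro x s
    have key : (⟨W.conjH1 p κ.kerSubgroup γ ((ι s : ↥(nonPrimitiveSelmerInfty W κ S₀)) :
        W.subgroupH1 p κ.kerSubgroup), DS.conj_mem _ (ι s).2⟩ : ↥(nonPrimitiveSelmerInfty W κ S₀)) =
        ι ⟨conjH1 κ.kerSubgroup (W.geomPrimaryTorsion p) γ s,
          conjH1_mem_datumSelmer κ.kerSubgroup (W.geomPrimaryTorsion p) p Lf _ γ s.2⟩ :=
      Subtype.ext ((congrArg (W.conjH1 p κ.kerSubgroup γ) (hιval s)).trans
        (hιval ⟨conjH1 κ.kerSubgroup (W.geomPrimaryTorsion p) γ s,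
          conjH1_mem_datumSelmer κ.kerSubgroup (W.geomPrimaryTorsion p) p Lf _ γ s.2⟩).symm)
    rw [htd, htd, htd, ← key]
    exact DS.toDual_T_smul x (ι s)
  have hCst : ∀ (c : ℤ_[p]) (x : DS.X) (s : ↥(datumSelmerInfty κ (W.geomPrimaryTorsion p) Lf S₀))
      (k : ℕ), (p ^ k) • s = 0 →
      td (PowerSeries.C c • x) s = (PadicInt.toZModPow k c).val • td x s := by
    intro c x s k hk
    rw [htd, htd]
    exact DS.toDual_C_smul c x (ι s) k (by rw [← map_nsmul, hk, map_zero])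
  exact ⟨{ X := DS.X, toDual := td, bijective := hbij, toDual_T_smul := hT, toDual_C_smul := hCst },
    ⟨LinearEquiv.refl _ _⟩⟩

/-- **The T-GV23L record read in CLASSICAL currency.** Given n1011-lit's cited record `h23`
(`datumSelmer_nonPrimitive_invariants`: GV Prop. (2.1) ⇒ Cor. (2.3) + Prop. (2.4) at the datum), a
family `Lf` of ramified ordinary lines above `p`, the subgroup equalities `Sel = S_A` and
`Sel^{Σ₀} = S^{Σ₀}_A` (p06's T-A240-PORT K1′), `p ∤ #E(ℚ)_tors` (so `H⁰(ℚ_∞, E[p^∞])` is finite), a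
f.g. TORSION dual datum `D` of `Sel` and ANY dual datum `DS` of `Sel^{Σ₀}` (`Σ₀ ∌ p` a finset): `DS.X`
is f.g. and torsion, `μ(DS.X) = μ(D.X)`, `λ(DS.X) = λ(D.X) + Σ_{v∈Σ₀} δ(E,v)`, and `Sel^{Σ₀}/Sel` is
`p`-divisible — exactly the binders `hrec`, `hdiv` of FILE K4a's
`mu_eq_zero_and_lambda_add_sum_delta_eq_of_congruence`. (`μ`, `λ`, finiteness and torsion move along
the `refl` equivalences of the two transports by the tree's invariance lemmas.)
[cite: GreenbergVatsal2000, §2 Cor. (2.3), Prop. (2.4) (arXiv:math/9906215 pp. 20–22)] -/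
theorem record_consequences_of_eq (h23 : datumSelmer_nonPrimitive_invariants) (hp2 : p ≠ 2)
    (hκ : κ.IsCyclotomic) (hγ : κ.IsTopGenerator γ) (Lf : Data ℚ (W.geomPrimaryTorsion p) p)
    (hLf : ∀ (v : HeightOneSpectrum (𝓞 ℚ)) (hv : ((p : ℕ) : 𝓞 ℚ) ∈ v.asIdeal),
      IsRamifiedOrdinaryLine W p (Lf v hv))
    (htors : ¬ p ∣ W.torsionOrder) (S₀ : Finset (HeightOneSpectrum (𝓞 ℚ)))
    (hS₀ : ∀ v ∈ S₀, ((p : ℕ) : 𝓞 ℚ) ∉ v.asIdeal)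
    (hSel : W.selmerInfty κ =
      datumSelmerInfty κ (W.geomPrimaryTorsion p) Lf (∅ : Set (HeightOneSpectrum (𝓞 ℚ))))
    (hNP : nonPrimitiveSelmerInfty W κ (↑S₀ : Set (HeightOneSpectrum (𝓞 ℚ))) =
      datumSelmerInfty κ (W.geomPrimaryTorsion p) Lf (↑S₀ : Set (HeightOneSpectrum (𝓞 ℚ))))
    (D : W.SelmerDualData κ γ) [Module.Finite (IwasawaAlgebra p) D.X] (hD : D.IsTorsion)
    (DS : NonPrimitiveDualData W κ γ (↑S₀ : Set (HeightOneSpectrum (𝓞 ℚ)))) :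
    Module.Finite (IwasawaAlgebra p) DS.X ∧ Module.IsTorsion (IwasawaAlgebra p) DS.X ∧
      muInvariant p DS.X = muInvariant p D.X ∧
      lambdaInvariant p DS.X = lambdaInvariant p D.X + ∑ v ∈ S₀, delta W p v ∧
      ∀ s ∈ nonPrimitiveSelmerInfty W κ (↑S₀ : Set (HeightOneSpectrum (𝓞 ℚ))),
        ∃ t ∈ nonPrimitiveSelmerInfty W κ (↑S₀ : Set (HeightOneSpectrum (𝓞 ℚ))),
          p • t - s ∈ W.selmerInfty κ := by
  obtain ⟨X, ⟨eX⟩⟩ := exists_datumDualData_of_selmerDualData Lf hSel D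
  obtain ⟨X₀, ⟨e₀⟩⟩ := exists_datumDualData_of_nonPrimitiveDualData Lf _ hNP DS
  haveI : Module.Finite (IwasawaAlgebra p) X.X := Module.Finite.equiv eX.symm
  have hXt : Module.IsTorsion (IwasawaAlgebra p) X.X :=
    IwasawaAlgebra.isTorsion_of_injective eX.toLinearMap eX.injective hD
  have hC : ∀ (v : HeightOneSpectrum (𝓞 ℚ)) (hv : ((p : ℕ) : 𝓞 ℚ) ∈ v.asIdeal),
      (∀ c ∈ (Lf v hv).plus, ∃ c' ∈ (Lf v hv).plus, p • c' = c) ∧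
        Nat.card ↥((Lf v hv).plus ⊓ (↥(W.geomPrimaryTorsion p))[(p : ℤ)]) = p :=
    fun v hv ↦ ⟨fun c hc ↦ (hLf v hv).divisible hc,
      AdditivePotMult.RamifiedLineUnique.natCard_plus_inf_torsionBy_eq (hLf v hv)⟩
  have hfix : Finite (FixedPoints.addSubgroup κ.kerSubgroup (W.geomPrimaryTorsion p)) :=
    finite_fixedPoints_of_not_dvd_torsionOrder W κ htors
  obtain ⟨hfg, htor, hμ, hlam, hdiv⟩ := h23 W p hp2 κ hκ γ hγ Lf hC hfix S₀ hS₀ X X₀ hXt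
  haveI : Module.Finite (IwasawaAlgebra p) X₀.X := hfg
  refine ⟨Module.Finite.equiv e₀, ?_, ?_, ?_, fun s hs ↦ ?_⟩
  · exact IwasawaAlgebra.isTorsion_of_injective e₀.symm.toLinearMap e₀.symm.injective htor
  · rw [← muInvariant_eq_of_linearEquiv e₀, hμ, muInvariant_eq_of_linearEquiv eX]
  · rw [← lambdaInvariant_eq_of_linearEquiv e₀, hlam, lambdaInvariant_eq_of_linearEquiv eX]
  · rw [hNP] at hs
    obtain ⟨t, ht, hts⟩ := hdiv s hs
    rw [← hSel] at hts
    rw [← hNP] at ht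
    exact ⟨t, ht, hts⟩

end RecordConsequences

/-! ## §3. A240 from the two records -/

section A240

/-- **A240 DERIVED from T-GV23L and A234.** Greenberg–Vatsal 2000, pp. 26–27 at the ramified ordinary
line (cc-typer-2's composed record `muLambdaAlg_transfer_of_torsionIso_potOrd_of_not_dvd_torsionOrder`,
VERBATIM): for `E₁, E₂/ℚ` globally minimal, `p` odd, `v ∋ p`, ramified ordinary lines `L₁`, `L₂`,
`p ∤ #E_i(ℚ)_tors`, ONE `Γ_ℚ`-equivariant `E₁[p] ≃+ E₂[p]` carrying `C₁[p]` onto `C₂[p]`, `Σ₀ ∌ p`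
with good reduction outside `Σ₀ ∪ {p}`, `κ` cyclotomic with topological generator `γ`, the R-D
identifications `hRD₁`, `hRD₂`, torsion f.g. dual data `D₁`, `D₂` with `μ(D₁) = 0`:
`μ(D₂) = 0 ∧ λ(D₁) + Σ_{v∈Σ₀} δ(E₁,v) = λ(D₂) + Σ_{v∈Σ₀} δ(E₂,v)` — GIVEN the two printed records
`h23` (GV Cor. (2.3) + Prop. (2.4) at the datum, n1011-lit) and `h414` (Greenberg 1999 Prop. 4.14).
Chain: §1 family shapes; §2 record consequences on both curves (X2's `nonPrimitiveDualData` as the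
non-primitive duals; p06's subgroup equalities); FILE K4a's core (count along the congruence with
T-GV29-MF's Remark-(2.9) clauses, gen-5 FILES 4–6, FILE K3's `hnf` on both sides).
[cite: GreenbergVatsal2000, §2 Prop. (2.8), Remark (2.9), Cor. (2.3), Prop. (2.4) and pp. 26–27]
[cite: GreenbergLNM1716, Prop. 4.14] -/
theorem muLambdaAlg_transfer_of_torsionIso_potOrd_of_not_dvd_torsionOrder_of_records
    (h23 : datumSelmer_nonPrimitive_invariants)
    (h414 : Greenberg1999.prop414_noFiniteSubmodule_of_not_dvd_torsionOrder) :
    muLambdaAlg_transfer_of_torsionIso_potOrd_of_not_dvd_torsionOrder := by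
  intro W₁ W₂ _ _ _ _ p _ hp2 v hpv L₁ L₂ hL₁ hL₂ htors₁ htors₂ hiso S₀ hS₀ hS₁ hS₂ κ γ hκ hγ _hcv hRD₁
    hRD₂ D₁ D₂ _ _ hX₁ hX₂ hμ₁
  obtain ⟨e, he, hmatch⟩ := hiso
  have hlines := forall_exists_lines_of_single hpv L₁ L₂ hL₁ hL₂ e hmatch
  have hRD₁' := forall_greenbergKer_eq_of_single hpv κ hL₁ hRD₁
  have hRD₂' := forall_greenbergKer_eq_of_single hpv κ hL₂ hRD₂
  choose Lf₁ Lf₂ hLf using hlines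
  have hS₀' : ∀ w ∈ (↑S₀ : Set (HeightOneSpectrum (𝓞 ℚ))), ((p : ℕ) : 𝓞 ℚ) ∉ w.asIdeal :=
    fun w hw ↦ hS₀ w (Finset.mem_coe.mp hw)
  -- the record on both curves, read on X2's non-primitive duals
  obtain ⟨hfg₁, ht₁, hμS₁, hlamS₁, hdiv₁⟩ := record_consequences_of_eq h23 hp2 hκ hγ Lf₁
    (fun w hw ↦ (hLf w hw).1) htors₁ S₀ hS₀
    (selmerInfty_eq_datumSelmerInfty W₁ p κ hp2 hκ Lf₁
      (fun w hw ↦ hRD₁' w hw (Lf₁ w hw) (hLf w hw).1))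
    (nonPrimitiveSelmerInfty_eq_datumSelmerInfty W₁ p κ (↑S₀ : Set (HeightOneSpectrum (𝓞 ℚ))) hp2 hκ
      Lf₁ (fun w hw ↦ hRD₁' w hw (Lf₁ w hw) (hLf w hw).1) hS₀')
    D₁ hX₁ (nonPrimitiveDualData W₁ κ (↑S₀ : Set (HeightOneSpectrum (𝓞 ℚ))) hγ)
  obtain ⟨hfg₂, ht₂, hμS₂, hlamS₂, hdiv₂⟩ := record_consequences_of_eq h23 hp2 hκ hγ Lf₂
    (fun w hw ↦ (hLf w hw).2.1) htors₂ S₀ hS₀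
    (selmerInfty_eq_datumSelmerInfty W₂ p κ hp2 hκ Lf₂
      (fun w hw ↦ hRD₂' w hw (Lf₂ w hw) (hLf w hw).2.1))
    (nonPrimitiveSelmerInfty_eq_datumSelmerInfty W₂ p κ (↑S₀ : Set (HeightOneSpectrum (𝓞 ℚ))) hp2 hκ
      Lf₂ (fun w hw ↦ hRD₂' w hw (Lf₂ w hw) (hLf w hw).2.1) hS₀')
    D₂ hX₂ (nonPrimitiveDualData W₂ κ (↑S₀ : Set (HeightOneSpectrum (𝓞 ℚ))) hγ)
  haveI := hfg₁
  haveI := hfg₂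
  exact mu_eq_zero_and_lambda_add_sum_delta_eq_of_congruence κ S₀ hp2 hκ hγ h414 e he
    (forall_exists_lines_of_single hpv L₁ L₂ hL₁ hL₂ e hmatch) hRD₁' hRD₂' htors₁ htors₂ hS₀ hS₁ hS₂
    D₁ D₂ hX₁ hX₂ hμ₁ _ _ ⟨ht₁, hμS₁, hlamS₁⟩ ⟨ht₂, hμS₂, hlamS₂⟩ hdiv₁ hdiv₂

end A240

end Summit.BirchSwinnertonDyer.Rank1Residual.Additive

end
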